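import Literature.AlgebraicGeometry.HodgeTheory.ComplexTorusIntegralHodgeClassesKunnethProjectorsNaturality
import HarnessLib

/-!
# The Künneth projectors diagonalise the graphs of the multiplications: `Γ_{n_X} ∘ π_s`, `π_s ∘ Γ_{n_X}`, `ᵗΓ_{n_X} ∘ π_s`, `π_s ∘ ᵗΓ_{n_X}`

Sequel of g29-#5 … #9. Birkenhake–Lange compute with the Künneth projectors `π_i` of an abelian variety through four identities with the graphs of the
multiplications `n_X` — "(6.17) `ᵗΓ_{n_X} ∘ π_i = (1_X × n_X)^* π_i = nⁱ π_i`", "(6.19) `π_i ∘ ᵗΓ_{n_X} = Σ_j nʲ π_i ∘ π_j = nⁱ π_i`" (p0318 L8–L28), and in the proof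
of Prop. 6.3.10 "`(n_X × 1_X)^* ᵗπ_i = nⁱ · ᵗπ_i`", "`ᵗπ_i ∘ ᵗΓ_{n_X} = (n_X × 1_X)_* ᵗπ_i = n^{2g−i} · ᵗπ_i`" (p0318 L50 – p0319 L3). This file states all of them for the
integral Künneth projectors `π_s = K_s[Δ_X] ∈ Hdgᵍ(X × X, ℤ)` of a complex torus `X` (dimension `g`, lattice rank `2g`), both as push-forwards / pull-backs along
`n_X × 1_X`, `1_X × n_X` and verbatim as Fulton compositions with `[Γ_{n_X}] = (1, n_X)_* 1_X`, `[ᵗΓ_{n_X}] = (n_X, 1)_* 1_X` (g27-#3/#6):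

* §1 **`integralHodgeClassesPushforward_prodMap_intMul_id_kunnethProjector`** `(n_X × 1_X)_* π_s = nˢ π_s` (g29-#7's Prop. 6.3.9 (b) at `f = n_X` + (6.17)) and
  **`integralHodgeClassesPushforward_prodMap_id_intMul_kunnethProjector`** `(1_X × n_X)_* π_s = n^{2g−s} π_s` (conjugation by `τ`, `τ_* π_s = π_{2g−s}`);
* §2 the four compositions, formed on `X × (X × X)` in any frame `eT` (g27-#5's convention `β ∘ α = p₁₃*(p₁₂^*α · p₂₃^*β)`):
  **`integralHodgeClassesCorrComp_kunnethProjector_transposeGraphClass_intMul`** (6.17) `ᵗΓ_{n_X} ∘ π_s = nˢ π_s` (g28-#3 `ᵗΓ_g ∘ α = (1 × g)^*α`),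
  **`integralHodgeClassesCorrComp_transposeGraphClass_intMul_kunnethProjector`** (6.19) `π_s ∘ ᵗΓ_{n_X} = nˢ π_s` (g28-#3 `Z′ ∘ ᵗΓ_f = (f × 1)_* Z′`),
  **`integralHodgeClassesCorrComp_kunnethProjector_graphClass_intMul`** `Γ_{n_X} ∘ π_s = n^{2g−s} π_s` (g27-#5 `Γ_g ∘ α = (1 × g)_* α`),
  **`integralHodgeClassesCorrComp_graphClass_intMul_kunnethProjector`** `π_s ∘ Γ_{n_X} = n^{2g−s} π_s` (g27-#5 `β ∘ Γ_f = (f × 1)^* β`); in particular the `π_s` commute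
  with `Γ_{n_X}` and `ᵗΓ_{n_X}` (Prop. 6.3.9 (b) for `f = n_X`).

## References
* [Lange2023AbelianVarietiesComplex] H. Lange, Abelian Varieties over the Complex Numbers, Springer 2023, §6.3.4 (6.17)–(6.19) (p0318 L8–L28), Prop. 6.3.10 (proof,
  p0318 L50 – p0319 L7), §6.2.2 Prop. 6.2.10.
* [Fulton1998] W. Fulton, Intersection Theory, 2nd ed., Springer 1998, §16.1 Def. 16.1.1, Prop. 16.1.1 (c).
-/

noncomputable section

open CategoryTheory Function

namespace Literature.AlgebraicGeometry.HodgeTheory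

open Literature.AlgebraicGeometry.Motives Literature.AlgebraicGeometry.Motives.HodgeStructure
open Literature.Geometry.Kaehler Literature.Geometry.Kaehler.ComplexTorus

namespace ComplexTorusCat

section Multiplication

variable (X : ComplexTorusCat) {g₁ g : ℕ} (hgg : g₁ + g₁ = g) (eX : Fin (2 * g₁) ≃ X.toIsog.ι) (e : Fin (2 * g) ≃ (prodObj X X).toIsog.ι)
  (hX : 2 * g₁ + 2 * 0 = 2 * g₁) (hg₁ : g₁ + g₁ = 2 * g₁) (hc : 2 * g₁ + 2 * g₁ = 2 * g) (hg' : g + g = 2 * g)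

/-! ### §1 Push-forwards along `n_X × 1_X` and `1_X × n_X` -/

/-- **`(n_X × 1_X)_* π_s = nˢ · π_s`** — Prop. 6.3.9 (b) for `f = n_X` (g29-#7: `(1_X × n_X)^* π_s = (n_X × 1_X)_* π_s`) combined with (6.17) `(1_X × n_X)^* π_s = nˢ π_s`
(g29-#6); Lange: "`ᵗπ_i ∘ ᵗΓ_{n_X} = (n_X × 1_X)_* ᵗπ_i`" in the proof of Prop. 6.3.10. [cite: Lange2023AbelianVarietiesComplex, §6.3.4 (6.17) (p0318 L8–L9) and Prop. 6.3.10 (proof, p0318 L52 – p0319 L1)] -/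
theorem integralHodgeClassesPushforward_prodMap_intMul_id_kunnethProjector (n : ℤ) (s : ℕ) :
    integralHodgeClassesPushforward g₁ g₁ (prodMap (intMul X n) (𝟙 X)) e e hc hg' hc hg' (kunnethProjector X eX e hX hg₁ hc hg' s) =
      (n ^ s) • kunnethProjector X eX e hX hg₁ hc hg' s := by
  rw [← integralHodgeClassesPullbackHom_prodMap_id_kunnethProjector (intMul X n) eX e hX hg₁ hc hg' eX e hX hg₁ hc hg' e hc hg' s,
    integralHodgeClassesPullbackHom_prodMap_id_intMul_kunnethProjector]

/-- `1_X × n_X = τ ≫ (n_X × 1_X) ≫ τ`. [cite: Lange2023AbelianVarietiesComplex, §6.3.4 Prop. 6.3.10 (proof, p0318 L52)] -/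
theorem swapHom_comp_prodMap_intMul_id_comp_swapHom (n : ℤ) :
    (swapHom X X ≫ prodMap (intMul X n) (𝟙 X)) ≫ swapHom X X = prodMap (𝟙 X) (intMul X n) := by
  rw [Category.assoc, prodMap_swapHom, ← Category.assoc, swapHom_swapHom, Category.id_comp]

/-- **`(1_X × n_X)_* π_s = n^{2g−s} · π_s`** (`s ≤ 2g`): `1 × n = τ ≫ (n × 1) ≫ τ`, `τ_* π_s = π_{2g−s}` (Prop. 6.3.10, g29-#5) and §1's `(n × 1)_* π_{2g−s} = n^{2g−s} π_{2g−s}`;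
Lange: "`= n^{2g−i} · ᵗπ_i`". [cite: Lange2023AbelianVarietiesComplex, §6.3.4 Prop. 6.3.10 (proof, p0318 L52 – p0319 L3)] -/
theorem integralHodgeClassesPushforward_prodMap_id_intMul_kunnethProjector (n : ℤ) {s : ℕ} (hs : s ≤ 2 * g₁) :
    integralHodgeClassesPushforward g₁ g₁ (prodMap (𝟙 X) (intMul X n)) e e hc hg' hc hg' (kunnethProjector X eX e hX hg₁ hc hg' s) =
      (n ^ (2 * g₁ - s)) • kunnethProjector X eX e hX hg₁ hc hg' s := by
  rw [← swapHom_comp_prodMap_intMul_id_comp_swapHom X n,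
    integralHodgeClassesPushforward_comp g₁ g₁ (swapHom X X ≫ prodMap (intMul X n) (𝟙 X)) e e hc hg' hc hg' g₁ (swapHom X X) e hc hg',
    integralHodgeClassesPushforward_comp g₁ g₁ (swapHom X X) e e hc hg' hc hg' g₁ (prodMap (intMul X n) (𝟙 X)) e hc hg',
    integralHodgeClassesPushforward_swapHom_kunnethProjector X eX e hX hg₁ hc hg' s (2 * g₁ - s) (by omega),
    integralHodgeClassesPushforward_prodMap_intMul_id_kunnethProjector X eX e hX hg₁ hc hg' n (2 * g₁ - s), map_zsmul,
    integralHodgeClassesPushforward_swapHom_kunnethProjector X eX e hX hg₁ hc hg' (2 * g₁ - s) s (by omega)]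

/-! ### §2 The four compositions with `Γ_{n_X}` and `ᵗΓ_{n_X}` -/

variable {gT : ℕ} (hT : g₁ + g = gT) (eT : Fin (2 * gT) ≃ (prodObj X (prodObj X X)).toIsog.ι) (hgT : gT + gT = 2 * gT) (hr : 2 * g₁ + 2 * g = 2 * gT)

include hT in
/-- **(6.17) `ᵗΓ_{n_X} ∘ π_s = nˢ · π_s`** — the composite `p₁₃*(p₁₂^*π_s · p₂₃^*[ᵗΓ_{n_X}])` on `X × (X × X)` with the transposed graph `[ᵗΓ_{n_X}] = (n_X, 1_X)_* 1_X` (g27-#6):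
"`ᵗΓ_{n_X} ∘ π_i = (1_X × n_X)^* π_i = nⁱ π_i`" (Prop. 6.2.10 (a), g28-#3 `integralHodgeClassesCorrComp_transposeGraphClass_right`, then g29-#6).
[cite: Lange2023AbelianVarietiesComplex, §6.3.4 (6.17) (p0318 L8–L9) and §6.2.2 Prop. 6.2.10 (a) (p0304 L25–L27)] -/
theorem integralHodgeClassesCorrComp_kunnethProjector_transposeGraphClass_intMul (n : ℤ) (s : ℕ) :
    integralHodgeClassesPushforward g g₁ (liftHom (fstHom X (prodObj X X)) (sndHom X (prodObj X X) ≫ sndHom X X)) eT e hr hgT hc hg'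
        (integralHodgeClassesCup (prodObj X (prodObj X X)).toIsog.Φ hgg
          (integralHodgeClassesPullbackHom (liftHom (fstHom X (prodObj X X)) (sndHom X (prodObj X X) ≫ fstHom X X)) g₁ (kunnethProjector X eX e hX hg₁ hc hg' s))
          (integralHodgeClassesPullbackHom (sndHom X (prodObj X X)) g₁
            (integralHodgeClassesPushforward 0 g₁ (liftHom (intMul X n) (𝟙 X)) eX e hX hg₁ hc hg' (unitIntegralHodgeClass X)))) =
      (n ^ s) • kunnethProjector X eX e hX hg₁ hc hg' s := by
  rw [integralHodgeClassesCorrComp_transposeGraphClass_right (intMul X n) hT eX eX e e e eT hX hg₁ hc hg' hg' hg' hgT hgg hc hr hc,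
    integralHodgeClassesPullbackHom_prodMap_id_intMul_kunnethProjector]

include hT in
/-- **(6.19) `π_s ∘ ᵗΓ_{n_X} = nˢ · π_s`** — "`π_i ∘ ᵗΓ_{n_X} = Σ_j nʲ π_i ∘ π_j = nⁱ π_i`"; here via Prop. 6.2.10 (b) `Z′ ∘ ᵗΓ_f = (f × 1)_* Z′` (g28-#3
`integralHodgeClassesCorrComp_transposeGraphClass_left`) and §1. [cite: Lange2023AbelianVarietiesComplex, §6.3.4 (6.19) (p0318 L26–L28) and §6.2.2 Prop. 6.2.10 (b) (p0304 L27)] -/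
theorem integralHodgeClassesCorrComp_transposeGraphClass_intMul_kunnethProjector (n : ℤ) (s : ℕ) :
    integralHodgeClassesPushforward g g₁ (liftHom (fstHom X (prodObj X X)) (sndHom X (prodObj X X) ≫ sndHom X X)) eT e hr hgT hc hg'
        (integralHodgeClassesCup (prodObj X (prodObj X X)).toIsog.Φ hgg
          (integralHodgeClassesPullbackHom (liftHom (fstHom X (prodObj X X)) (sndHom X (prodObj X X) ≫ fstHom X X)) g₁
            (integralHodgeClassesPushforward 0 g₁ (liftHom (intMul X n) (𝟙 X)) eX e hX hg₁ hc hg' (unitIntegralHodgeClass X)))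
          (integralHodgeClassesPullbackHom (sndHom X (prodObj X X)) g₁ (kunnethProjector X eX e hX hg₁ hc hg' s))) =
      (n ^ s) • kunnethProjector X eX e hX hg₁ hc hg' s := by
  rw [integralHodgeClassesCorrComp_transposeGraphClass_left (intMul X n) (by omega : g + g₁ = gT) eX eX e e e eT hX hg₁ hc hg' hg' hg' hgT hgg hc hr hc,
    integralHodgeClassesPushforward_prodMap_intMul_id_kunnethProjector]

include hT in
/-- **`ᵗΓ_{n_X} ∘ π_s = π_s ∘ ᵗΓ_{n_X}`** — Prop. 6.3.9 (b) for `f = n_X` (both sides are `nˢ π_s`, (6.17) and (6.19)). [cite: Lange2023AbelianVarietiesComplex, §6.3.4 Prop. 6.3.9 (b) (p0318 L1–L7, L22–L28)] -/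
theorem integralHodgeClassesCorrComp_kunnethProjector_transposeGraphClass_intMul_comm (n : ℤ) (s : ℕ) :
    integralHodgeClassesPushforward g g₁ (liftHom (fstHom X (prodObj X X)) (sndHom X (prodObj X X) ≫ sndHom X X)) eT e hr hgT hc hg'
        (integralHodgeClassesCup (prodObj X (prodObj X X)).toIsog.Φ hgg
          (integralHodgeClassesPullbackHom (liftHom (fstHom X (prodObj X X)) (sndHom X (prodObj X X) ≫ fstHom X X)) g₁ (kunnethProjector X eX e hX hg₁ hc hg' s))
          (integralHodgeClassesPullbackHom (sndHom X (prodObj X X)) g₁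
            (integralHodgeClassesPushforward 0 g₁ (liftHom (intMul X n) (𝟙 X)) eX e hX hg₁ hc hg' (unitIntegralHodgeClass X)))) =
      integralHodgeClassesPushforward g g₁ (liftHom (fstHom X (prodObj X X)) (sndHom X (prodObj X X) ≫ sndHom X X)) eT e hr hgT hc hg'
        (integralHodgeClassesCup (prodObj X (prodObj X X)).toIsog.Φ hgg
          (integralHodgeClassesPullbackHom (liftHom (fstHom X (prodObj X X)) (sndHom X (prodObj X X) ≫ fstHom X X)) g₁
            (integralHodgeClassesPushforward 0 g₁ (liftHom (intMul X n) (𝟙 X)) eX e hX hg₁ hc hg' (unitIntegralHodgeClass X)))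
          (integralHodgeClassesPullbackHom (sndHom X (prodObj X X)) g₁ (kunnethProjector X eX e hX hg₁ hc hg' s))) := by
  rw [integralHodgeClassesCorrComp_kunnethProjector_transposeGraphClass_intMul X hgg eX e hX hg₁ hc hg' hT eT hgT hr,
    integralHodgeClassesCorrComp_transposeGraphClass_intMul_kunnethProjector X hgg eX e hX hg₁ hc hg' hT eT hgT hr]

include hT in
/-- **`Γ_{n_X} ∘ π_s = n^{2g−s} · π_s`** (`s ≤ 2g`) — Fulton's Prop. 16.1.1 (c)(i) `Γ_g ∘ α = (1 × g)_* α` (g27-#5 `integralHodgeClassesCorrComp_graphClass_right`) and §1's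
`(1_X × n_X)_* π_s = n^{2g−s} π_s` ((6.17)/(6.19) transposed: `Γ_n = ᵗ(ᵗΓ_n)`, `ᵗπ_s = π_{2g−s}`). [cite: Lange2023AbelianVarietiesComplex, §6.3.4 Prop. 6.3.10 (proof, p0318 L50 – p0319 L3)]
[cite: Fulton1998, §16.1 Prop. 16.1.1 (c)(i) (p0293 L24)] -/
theorem integralHodgeClassesCorrComp_kunnethProjector_graphClass_intMul (n : ℤ) {s : ℕ} (hs : s ≤ 2 * g₁) :
    integralHodgeClassesPushforward g g₁ (liftHom (fstHom X (prodObj X X)) (sndHom X (prodObj X X) ≫ sndHom X X)) eT e hr hgT hc hg'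
        (integralHodgeClassesCup (prodObj X (prodObj X X)).toIsog.Φ hgg
          (integralHodgeClassesPullbackHom (liftHom (fstHom X (prodObj X X)) (sndHom X (prodObj X X) ≫ fstHom X X)) g₁ (kunnethProjector X eX e hX hg₁ hc hg' s))
          (integralHodgeClassesPullbackHom (sndHom X (prodObj X X)) g₁
            (integralHodgeClassesPushforward 0 g₁ (graphHom (intMul X n)) eX e hX hg₁ hc hg' (unitIntegralHodgeClass X)))) =
      (n ^ (2 * g₁ - s)) • kunnethProjector X eX e hX hg₁ hc hg' s := by
  rw [integralHodgeClassesCorrComp_graphClass_right (by omega : g + g₁ = gT) (intMul X n) eX eX e e e eT hX hg₁ hc hg' (by omega : 2 * g + 2 * 0 = 2 * g) hg'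
      (by omega : 2 * g + 2 * g₁ = 2 * gT) hgT hg' hgg hc hr hc,
    integralHodgeClassesPushforward_prodMap_id_intMul_kunnethProjector X eX e hX hg₁ hc hg' n hs]

include hT in
/-- **`π_s ∘ Γ_{n_X} = n^{2g−s} · π_s`** (`s ≤ 2g`) — Prop. 16.1.1 (c)(ii) `β ∘ Γ_f = (f × 1)^* β` (g27-#5 `integralHodgeClassesCorrComp_graphClass_left`) and g29-#6's
`(n_X × 1_X)^* π_s = n^{2g−s} π_s` ("`(n_X × 1_X)^* ᵗπ_i = nⁱ · ᵗπ_i`" with `ᵗπ_i = π_{2g−i}`). [cite: Lange2023AbelianVarietiesComplex, §6.3.4 Prop. 6.3.10 (proof, p0318 L50–L51)]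
[cite: Fulton1998, §16.1 Prop. 16.1.1 (c)(ii) (p0293 L25)] -/
theorem integralHodgeClassesCorrComp_graphClass_intMul_kunnethProjector (n : ℤ) {s : ℕ} (hs : s ≤ 2 * g₁) :
    integralHodgeClassesPushforward g g₁ (liftHom (fstHom X (prodObj X X)) (sndHom X (prodObj X X) ≫ sndHom X X)) eT e hr hgT hc hg'
        (integralHodgeClassesCup (prodObj X (prodObj X X)).toIsog.Φ hgg
          (integralHodgeClassesPullbackHom (liftHom (fstHom X (prodObj X X)) (sndHom X (prodObj X X) ≫ fstHom X X)) g₁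
            (integralHodgeClassesPushforward 0 g₁ (graphHom (intMul X n)) eX e hX hg₁ hc hg' (unitIntegralHodgeClass X)))
          (integralHodgeClassesPullbackHom (sndHom X (prodObj X X)) g₁ (kunnethProjector X eX e hX hg₁ hc hg' s))) =
      (n ^ (2 * g₁ - s)) • kunnethProjector X eX e hX hg₁ hc hg' s := by
  rw [integralHodgeClassesCorrComp_graphClass_left hT (intMul X n) eX eX e e eT hX hg₁ hc hg' (by omega : 2 * g + 2 * 0 = 2 * g) hg'
      (by omega : 2 * g + 2 * g₁ = 2 * gT) hgT hgg hc hr,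
    integralHodgeClassesPullbackHom_prodMap_intMul_id_kunnethProjector X eX e hX hg₁ hc hg' n hs]

include hT in
/-- **`Γ_{n_X} ∘ π_s = π_s ∘ Γ_{n_X}`**: the Künneth projectors commute with the graphs of the multiplications (both sides `n^{2g−s} π_s`; `π_s = 0` for `s > 2g`).
[cite: Lange2023AbelianVarietiesComplex, §6.3.4 Prop. 6.3.9 (b) (p0318 L1–L7)] -/
theorem integralHodgeClassesCorrComp_kunnethProjector_graphClass_intMul_comm (n : ℤ) (s : ℕ) :
    integralHodgeClassesPushforward g g₁ (liftHom (fstHom X (prodObj X X)) (sndHom X (prodObj X X) ≫ sndHom X X)) eT e hr hgT hc hg'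
        (integralHodgeClassesCup (prodObj X (prodObj X X)).toIsog.Φ hgg
          (integralHodgeClassesPullbackHom (liftHom (fstHom X (prodObj X X)) (sndHom X (prodObj X X) ≫ fstHom X X)) g₁ (kunnethProjector X eX e hX hg₁ hc hg' s))
          (integralHodgeClassesPullbackHom (sndHom X (prodObj X X)) g₁
            (integralHodgeClassesPushforward 0 g₁ (graphHom (intMul X n)) eX e hX hg₁ hc hg' (unitIntegralHodgeClass X)))) =
      integralHodgeClassesPushforward g g₁ (liftHom (fstHom X (prodObj X X)) (sndHom X (prodObj X X) ≫ sndHom X X)) eT e hr hgT hc hg'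
        (integralHodgeClassesCup (prodObj X (prodObj X X)).toIsog.Φ hgg
          (integralHodgeClassesPullbackHom (liftHom (fstHom X (prodObj X X)) (sndHom X (prodObj X X) ≫ fstHom X X)) g₁
            (integralHodgeClassesPushforward 0 g₁ (graphHom (intMul X n)) eX e hX hg₁ hc hg' (unitIntegralHodgeClass X)))
          (integralHodgeClassesPullbackHom (sndHom X (prodObj X X)) g₁ (kunnethProjector X eX e hX hg₁ hc hg' s))) := by
  by_cases hs : s ≤ 2 * g₁
  · rw [integralHodgeClassesCorrComp_kunnethProjector_graphClass_intMul X hgg eX e hX hg₁ hc hg' hT eT hgT hr n hs,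
      integralHodgeClassesCorrComp_graphClass_intMul_kunnethProjector X hgg eX e hX hg₁ hc hg' hT eT hgT hr n hs]
  · rw [kunnethProjector_eq_zero_of_lt X eX e hX hg₁ hc hg' (not_le.1 hs), map_zero, map_zero, AddMonoidHom.zero_apply, map_zero, map_zero, map_zero, map_zero]

end Multiplication

end ComplexTorusCat

end Literature.AlgebraicGeometry.HodgeTheory
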